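import Summits.AtomisticToContinuum.HydrodynamicLimit.Theorems.StiffCollisionalRelaxationAprioriBoundsFibreDefsR4
import Summits.AtomisticToContinuum.HydrodynamicLimit.Theorems.StiffCollisionalRelaxationAprioriBoundsFibreFarTail
import Summits.AtomisticToContinuum.HydrodynamicLimit.Theorems.StiffCollisionalRelaxationAprioriBoundsVelocityTailsOfGaussianVelocityTails
import Summits.AtomisticToContinuum.HydrodynamicLimit.Theorems.StiffCollisionalRelaxationAprioriBoundsVelocityTailsHomogeneous
import Summits.AtomisticToContinuum.HydrodynamicLimit.Theorems.StiffCollisionalRelaxationAprioriBoundsPartOneChain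
import Literature.Barriers.AtomisticToContinuum.HighMomentumCutoff
import HarnessLib

/-!
# The all-levels far-tail input `FarTailAllAt` from Gaussian velocity tails in the mean
(line `fibre-deficit-transfer`, crux `StiffCollisionalRelaxation.AprioriBounds` =
`CollisionIsometryCLT.AprioriBoundsPreShock`, stmt-AtomisticToContinuum-14827; skeleton r4, stub `stub_farTailAll`)

Supporting file (`--supports stmt-AtomisticToContinuum-14827`) of the lead prover
`prover-line-stmt-AtomisticToContinuum-14827-a1-0` (skeleton r4, the rate-free time-integrated (i)-chain).  The
registered stub `stub_farTailAll` asks, under the crux prefix (profiles → `∃ σ₀ ∃ η₁ ∀ σ < σ₀` → classical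
hs-Euler solution on `[0, T)` → flow family with the `t = 0` LLN → `0 < t < T` with the chamber `2ρσ³ < η₁` on
`[0, t]`), for the SLACK-FREE, ALL-LEVELS far-tail occupation package `FarTailAllAt σ a₀ θ₀ u₀ Φ t` of the line's
vocabulary (`…AprioriBoundsFibreDefsR4`): the EXPECTED time-integrated one-particle occupation of the velocity
levels `{|v|² ≥ K}`, `E_N ∫₀ᵗ frac_K(Φ_s z) ds`, is at most `t·A·e^{−K/(2Θ)}` eventually in `N`, for EVERY real `K`.
This is an OPEN dynamical input; this file records what the tree offers towards it (the Markov–Tonelli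
reduction of the landed wave-1 file `…FibreFarTail`, re-run with the slack-free conclusion; the pointwise Markov
step `ofReal_frac_le_expVelocityMoment` — `frac_K(w) ≤ e^{−cK}·(N+1)⁻¹∑ᵢ e^{c|vᵢ|²}` for `c ≥ 0`, every `K ∈ ℝ` —
is imported from there).

* `farTailAll_of_expVelocityMoment` — THE REDUCTION (Markov + Tonelli along the flow): an expected Gaussian
  velocity moment at rate `c > 0` along the flow family, `E_{P_N} expVelocityMoment c (Φ_N(s) ·) ≤ C < ⊤` for
  `N ≥ N₀`, `s ∈ [0, t]`, gives `FarTailAllAt σ a₀ θ₀ u₀ Φ t` with `Θ := 1/(2c)`, `A := C.toReal` and the same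
  `N₀` — for ANY `σ`, profiles and flows (the local Gibbs law is s-finite and carried by the good set, where the
  flow is jointly measurable: `AdiabatCeiling.aemeasurable_comp_flow_prod₂`).
* `farTailAll_of_gaussianVelocityTails` (REGISTERED sub-goal) — hence the route item
  `SpeedCapSurgery.GaussianVelocityTails` (stmt-AtomisticToContinuum-9633, open) implies the statement of
  `stub_farTailAll` VERBATIM, through the landed dock `AdiabatCeiling.stub_velocityTails_of_gaussianVelocityTails`.
* `farTailAll_of_highMomentumCutoff` — the same from `HighMomentumCutoff σ` for all small `σ`
  (`AdiabatCeiling.velocityTails_of_highMomentumCutoff`).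
* `farTailAll_homogeneous` — the EQUILIBRIUM INSTANCE of `stub_farTailAll`, PROVED for every flow family: at the
  homogeneous profiles `(a₀, u₀, θ₀) = (1, 0, θ₀)` the landed `AdiabatCeiling.velocityTails_homogeneous` supplies
  the expected Gaussian moment, so `FarTailAllAt` holds under the crux prefix.
* `FarTailAllAt.farTailAt` (vocabulary) then gives the r2 package `FarTailAt` as well (= the landed
  `farTailAt_of_expVelocityMoment` of `…FibreFarTail`).

No new definitions, no named facts; axioms `propext`, `Classical.choice`, `Quot.sound`.
-/

noncomputable section

open MeasureTheory Filter Set Topology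
open scoped ENNReal

namespace Summit.AtomisticToContinuum.HydrodynamicLimit.Theorems.FibreDeficitTransfer

open Literature.MathematicalPhysics.KineticTheory Literature.Analysis.FluidPDE
open Summit.AtomisticToContinuum.HydrodynamicLimit.Theorems.AprioriBoundsNegative (PartOneAt PartTwoAt)
open Summit.AtomisticToContinuum.HydrodynamicLimit.Theorems.VisitLedgerUpscattering (Cfg Flow Flows NiceProfiles)
open Literature.Barriers.AtomisticToContinuum (expVelocityMoment HighMomentumCutoff)

/-! ## The reduction: `FarTailAllAt` from an expected Gaussian moment along the flow -/

/-- **`FarTailAllAt` FROM AN EXPECTED GAUSSIAN VELOCITY MOMENT ALONG THE FLOW** (Markov + Tonelli).  For any `σ`,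
profiles, flow family `Φ`, horizon `t`, rate `c > 0`, constant `C < ⊤` and threshold `N₀`: if
`∫⁻ expVelocityMoment c (Φ_N(s) z) dλ^N ≤ C` for all `N ≥ N₀` and `s ∈ [0, t]`, then `FarTailAllAt σ a₀ θ₀ u₀ Φ t`
with the witnesses `Θ := 1/(2c)`, `A := C.toReal`, `N₀` — at EVERY real level `K`.  Pointwise
`ofReal (frac_K) ≤ e^{−cK} expVelocityMoment c` (`ofReal_frac_le_expVelocityMoment`, landed in `…FibreFarTail`); the local Gibbs law is s-finite and
charges only the good set, on which `(z, s) ↦ Φ_s z` is jointly measurable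
(`AdiabatCeiling.aemeasurable_comp_flow_prod₂`), so Tonelli applies and each time slice contributes `≤ C`. -/
-- adapted from `…FibreFarTail.farTailAt_of_expVelocityMoment` (landed): same argument, slack-free conclusion
theorem farTailAll_of_expVelocityMoment {σ : ℝ} {a₀ θ₀ : T3 → ℝ} {u₀ : T3 → V3} {Φ : Flows σ} {t c : ℝ}
    {C : ℝ≥0∞} {N₀ : ℕ} (hc : 0 < c) (hC : C < ⊤)
    (hmom : ∀ N : ℕ, N₀ ≤ N → ∀ s ∈ Icc 0 t,
      ∫⁻ z, expVelocityMoment c ((Φ N).flow s z) ∂(localGibbsLaw σ a₀ u₀ θ₀ N (Φ N)) ≤ C) :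
    FarTailAllAt σ a₀ θ₀ u₀ Φ t := by
  refine ⟨1 / (2 * c), C.toReal, by positivity, N₀, fun N hN K => ?_⟩
  set P : Measure (Cfg N) := localGibbsLaw σ a₀ u₀ θ₀ N (Φ N) with hP
  set ν : Measure ℝ := volume.restrict (Icc 0 t) with hν
  -- the law is s-finite (a density against Lebesgue measure) and carried by the good set
  haveI hXE : SigmaFinite (volume : Measure (T3 × V3)) := inferInstance
  haveI hCfg : SigmaFinite (volume : Measure (Config (N + 1) (Fin 3) T3)) := inferInstance
  haveI hPs : SFinite P := by
    rw [hP, localGibbsLaw_eq]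
    unfold localGibbsMeasure
    infer_instance
  have hgood0 : P (Φ N).goodᶜ = 0 := by
    rw [hP, localGibbsLaw_eq]
    exact (localGibbsMeasure_absolutelyContinuous σ _ _ _ N (Φ N)) (Φ N).measure_compl_good
  -- the observable is measurable, hence a.e.-jointly measurable along the flow
  have hMm : Measurable (fun w : Cfg N => expVelocityMoment c w) := by
    refine (measurable_const.mul (Finset.measurable_sum _ fun i _ => ?_)).ennreal_ofReal
    exact ((measurable_pi_apply i).snd.norm.pow_const 2 |>.const_mul c).exp
  have hprod : AEMeasurable (fun p : Cfg N × ℝ => expVelocityMoment c ((Φ N).flow p.2 p.1)) (P.prod ν) :=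
    AdiabatCeiling.aemeasurable_comp_flow_prod₂ (Φ N) (hMm.comp measurable_fst) hgood0 ν
  -- (1) pointwise Markov under both integrals
  have h1 : ∫⁻ z, (∫⁻ s in Icc 0 t, ENNReal.ofReal (frac K ((Φ N).flow s z))) ∂P ≤
      ENNReal.ofReal (Real.exp (-(c * K))) * ∫⁻ z, ∫⁻ s, expVelocityMoment c ((Φ N).flow s z) ∂ν ∂P := by
    rw [← lintegral_const_mul' _ _ ENNReal.ofReal_ne_top]
    refine lintegral_mono fun z => ?_
    rw [← lintegral_const_mul' _ _ ENNReal.ofReal_ne_top]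
    exact lintegral_mono fun s => ofReal_frac_le_expVelocityMoment hc.le K _
  -- (2) Tonelli
  have h2 : ∫⁻ z, ∫⁻ s, expVelocityMoment c ((Φ N).flow s z) ∂ν ∂P =
      ∫⁻ s, ∫⁻ z, expVelocityMoment c ((Φ N).flow s z) ∂P ∂ν :=
    lintegral_lintegral_swap hprod
  -- (3) each time slice contributes at most `C`
  have h3 : ∫⁻ s, ∫⁻ z, expVelocityMoment c ((Φ N).flow s z) ∂P ∂ν ≤ C * ENNReal.ofReal t := by
    have hae : ∀ᵐ s ∂ν, ∫⁻ z, expVelocityMoment c ((Φ N).flow s z) ∂P ≤ C := by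
      rw [hν, ae_restrict_iff' measurableSet_Icc]
      exact ae_of_all _ fun s hs => hmom N hN s hs
    calc ∫⁻ s, ∫⁻ z, expVelocityMoment c ((Φ N).flow s z) ∂P ∂ν ≤ ∫⁻ _s, C ∂ν := lintegral_mono_ae hae
      _ = C * ENNReal.ofReal t := by
          rw [lintegral_const, hν, Measure.restrict_apply_univ, Real.volume_Icc, sub_zero]
  -- (4) assemble
  calc ∫⁻ z, (∫⁻ s in Icc 0 t, ENNReal.ofReal (frac K ((Φ N).flow s z))) ∂P
      ≤ ENNReal.ofReal (Real.exp (-(c * K))) * (C * ENNReal.ofReal t) := by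
        refine h1.trans ?_
        rw [h2]
        exact mul_le_mul' le_rfl h3
    _ = ENNReal.ofReal (t * C.toReal * Real.exp (-(K / (2 * (1 / (2 * c)))))) := by
        have hK : K / (2 * (1 / (2 * c))) = c * K := by
          field_simp
        rw [hK, show t * C.toReal * Real.exp (-(c * K)) = Real.exp (-(c * K)) * (C.toReal * t) by ring,
          ENNReal.ofReal_mul (Real.exp_pos _).le, ENNReal.ofReal_mul ENNReal.toReal_nonneg,
          ENNReal.ofReal_toReal hC.ne]

/-! ## Docks: the registered sub-goal and its literature twin -/

/-- REGISTERED SUB-GOAL `farTailAll_of_gaussianVelocityTails` of the crux (stub `stub_farTailAll` of the line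
`fibre-deficit-transfer`, skeleton r4): **the route item `SpeedCapSurgery.GaussianVelocityTails`
(stmt-AtomisticToContinuum-9633) implies the statement of `stub_farTailAll` verbatim.**  The landed dock
`AdiabatCeiling.stub_velocityTails_of_gaussianVelocityTails` turns the item into the expected Gaussian moment along
the flow under the crux prefix (horizon `T := t`), and `farTailAll_of_expVelocityMoment` is Markov + Tonelli. -/
theorem farTailAll_of_gaussianVelocityTails : Summit.AtomisticToContinuum.HydrodynamicLimit.Theses.SpeedCapSurgery.GaussianVelocityTails → ∀ (a₀ θ₀ : T3 → ℝ) (u₀ : T3 → V3), Continuous a₀ → Continuous θ₀ → Continuous u₀ → (∀ x, 0 < a₀ x) → (∀ x, 0 < θ₀ x) → ∃ σ₀ : ℝ, 0 < σ₀ ∧ ∃ η₁ : ℝ, 0 < η₁ ∧ ∀ σ : ℝ, 0 < σ → σ < σ₀ → ∀ (T : ℝ) (ρ θ : ℝ → T3 → ℝ) (u : ℝ → T3 → V3), IsHardSphereEulerSolution σ T ρ u θ → ∀ Φ : (N : ℕ) → HardSphereFlow (Torus.geometry (Fin 3)) (hsDiameter σ N) (N + 1), TendstoHydroFieldsAt (fun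 N => localGibbsLaw σ a₀ u₀ θ₀ N (Φ N)) Φ ρ u θ 0 → ∀ t : ℝ, 0 < t → t < T → (∀ s ∈ Icc 0 t, ∀ x, 2 * ρ s x * σ ^ 3 < η₁) → FarTailAllAt σ a₀ θ₀ u₀ Φ t := by
  intro h a₀ θ₀ u₀ ha hθ hu ha0 hθ0
  obtain ⟨σ₀, hσ₀, η₁, hη₁, hb⟩ :=
    AdiabatCeiling.stub_velocityTails_of_gaussianVelocityTails h a₀ θ₀ u₀ ha hθ hu ha0 hθ0
  refine ⟨σ₀, hσ₀, η₁, hη₁, fun σ hσ hσlt T ρ θ u hsol Φ hLLN t ht htT hdil => ?_⟩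
  obtain ⟨c, hc, C, hC, N₀, hmom⟩ := hb σ hσ hσlt T ρ θ u hsol Φ hLLN t ht htT hdil
  exact farTailAll_of_expVelocityMoment hc hC hmom

/-- The same conclusion from the literature hypothesis `HighMomentumCutoff σ` for all small `σ`
(Nachtergaele–Yau's Assumption II.1 transcribed to hard spheres, `Literature/Barriers/…/HighMomentumCutoff.lean`;
open, asserted nowhere), through `AdiabatCeiling.velocityTails_of_highMomentumCutoff`. -/
theorem farTailAll_of_highMomentumCutoff :
    (∃ σ₀ : ℝ, 0 < σ₀ ∧ ∀ σ : ℝ, 0 < σ → σ < σ₀ → HighMomentumCutoff σ) →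
    ∀ (a₀ θ₀ : T3 → ℝ) (u₀ : T3 → V3), Continuous a₀ → Continuous θ₀ → Continuous u₀ →
      (∀ x, 0 < a₀ x) → (∀ x, 0 < θ₀ x) →
      ∃ σ₀ : ℝ, 0 < σ₀ ∧ ∃ η₁ : ℝ, 0 < η₁ ∧ ∀ σ : ℝ, 0 < σ → σ < σ₀ →
        ∀ (T : ℝ) (ρ θ : ℝ → T3 → ℝ) (u : ℝ → T3 → V3), IsHardSphereEulerSolution σ T ρ u θ →
        ∀ Φ : (N : ℕ) → HardSphereFlow (Torus.geometry (Fin 3)) (hsDiameter σ N) (N + 1),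
          TendstoHydroFieldsAt (fun N => localGibbsLaw σ a₀ u₀ θ₀ N (Φ N)) Φ ρ u θ 0 →
          ∀ t : ℝ, 0 < t → t < T → (∀ s ∈ Icc 0 t, ∀ x, 2 * ρ s x * σ ^ 3 < η₁) →
            FarTailAllAt σ a₀ θ₀ u₀ Φ t := by
  intro h a₀ θ₀ u₀ ha hθ hu ha0 hθ0
  obtain ⟨σ₀, hσ₀, η₁, hη₁, hb⟩ :=
    AdiabatCeiling.velocityTails_of_highMomentumCutoff h a₀ θ₀ u₀ ha hθ hu ha0 hθ0
  refine ⟨σ₀, hσ₀, η₁, hη₁, fun σ hσ hσlt T ρ θ u hsol Φ hLLN t ht htT hdil => ?_⟩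
  obtain ⟨c, hc, C, hC, N₀, hmom⟩ := hb σ hσ hσlt T ρ θ u hsol Φ hLLN t ht htT hdil
  exact farTailAll_of_expVelocityMoment hc hC hmom

/-! ## The equilibrium instance (proved) -/

/-- **`stub_farTailAll` AT HOMOGENEOUS DATA, for every flow family (PROVED).**  At the profiles `(1, 0, θ₀)`,
`θ₀ > 0` constant: there are `σ₀ > 0` and `η₁ > 0` such that for all `0 < σ < σ₀`, every family of hard-sphere
flows and every `0 < t < T` (the rest of the crux prefix being idle), `FarTailAllAt σ 1 θ₀ 0 Φ t` holds: the
landed `AdiabatCeiling.velocityTails_homogeneous` gives the expected Gaussian velocity moment along the flow, and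
`farTailAll_of_expVelocityMoment` concludes.  This is the equilibrium unit test of the skeleton's stub 4. -/
theorem farTailAll_homogeneous :
    ∀ θ₀ : ℝ, 0 < θ₀ →
      ∃ σ₀ : ℝ, 0 < σ₀ ∧ ∃ η₁ : ℝ, 0 < η₁ ∧ ∀ σ : ℝ, 0 < σ → σ < σ₀ →
        ∀ (T : ℝ) (ρ θ : ℝ → T3 → ℝ) (u : ℝ → T3 → V3), IsHardSphereEulerSolution σ T ρ u θ →
        ∀ Φ : (N : ℕ) → HardSphereFlow (Torus.geometry (Fin 3)) (hsDiameter σ N) (N + 1),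
          TendstoHydroFieldsAt
              (fun N => localGibbsLaw σ (fun _ => 1) (fun _ => 0) (fun _ => θ₀) N (Φ N)) Φ ρ u θ 0 →
          ∀ t : ℝ, 0 < t → t < T → (∀ s ∈ Icc 0 t, ∀ x, 2 * ρ s x * σ ^ 3 < η₁) →
            FarTailAllAt σ (fun _ => 1) (fun _ => θ₀) (fun _ => 0) Φ t := by
  intro θ₀ hθ₀
  obtain ⟨σ₀, hσ₀, η₁, hη₁, hb⟩ := AdiabatCeiling.velocityTails_homogeneous θ₀ hθ₀
  refine ⟨σ₀, hσ₀, η₁, hη₁, fun σ hσ hσlt T ρ θ u hsol Φ hLLN t ht htT hdil => ?_⟩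
  obtain ⟨c, hc, C, hC, N₀, hmom⟩ := hb σ hσ hσlt T ρ θ u hsol Φ hLLN t ht htT hdil
  exact farTailAll_of_expVelocityMoment hc hC hmom

end Summit.AtomisticToContinuum.HydrodynamicLimit.Theorems.FibreDeficitTransfer

end
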